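import Summits.BirchSwinnertonDyer.Rank1Residual.GaloisImage.KolyvaginLevelTwoNineDivides
import Summits.BirchSwinnertonDyer.Rank1Residual.GaloisImage.KolyvaginBaseRigidityDeep
import HarnessLib

/-!
# END-m2 "nine divides Ш" with its injectivity input DISCHARGED by base rigidity on the deep-class
# datum (cell `b2b-bsdres`, team n1011, seat p15 GEN 4, OWNERS row T-INJ-DEV file F-E2; ROUTE-1
# R1-58 × §33.3; skeleton `cells/n1011/skel/T-INJ-DEV.md`)

HONEST FRAMING (cell `b2b-bsdres`, run/shared/lean/b2b/bsd-rank1-residual/, verbatim in every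
file): the goal of the cell is to DELETE the COMBINATION-SHAPED residual classes of the
Birch–Swinnerton-Dyer formula for ALL analytic-rank `≤ 1` elliptic curves over `ℚ` — "full BSD
formula for every rank `≤ 1` curve in class `C`" assembled STRICTLY from published theorems — so
that the rank-`≤ 1` remainder becomes exactly the CONSTRUCTION-SHAPED classes, which are TYPED
(missing-input `Prop`s), NOT attempted. This is not "finishing BSD". Team n1011 (N10 / N11, the
additive block X4 ∧ `p = 3`): research route on the CONSTRUCTION-SHAPED class X4; prove what is
provable now; no claim beyond stated classes; nothing is booked; no label and no RESIDUAL-MAP mark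
is moved. END-m2 is DEBT REDUCTION on class A2, NOT coverage; the PORT (DICT3 at depth 1) stays a
HYPOTHESIS; its other non-trivial input `hinj` is now the theorem
`kolyvaginSystem_eq_zero_of_apply_empty_eq_zero_of_baseRigidity_deep` (F-E1). Theorems only: no
definition, no named fact, no `sorry`.

## What

* **`exists_ne_zero_mem_selmerGroup_three_of_dictionaryTwo_of_levelTwo_certificate_of_baseRigidity`**
  — END-m2 (n1011-p15 F-D) with `hinj`, `h0`, `hadm₉`, `h𝓕₉`, `h𝓕₃`, `hPS`, `hP₉` SUPPLIED: binders =
  F-D's MINUS those PLUS {`1 ≤ k′` and the PIN `D₉.primes = frobeniusClassPrimes (E[3^{k′}·3]) {v | inr v ∈ S} τ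
  3^{k′+1}` (`k′ = 2` is the port guard's deep class), `τ ∈ Gal(ℚ̄/ℚ(μ_{3^{k′+1}}))`, `∞ ⊆ S`};
  counting form `natCard_selmerGroup_three_ne_one_of_dictionaryTwo_of_levelTwo_certificate_of_baseRigidity`
  (`#Sel^{(3)}(E/ℚ) ≠ 1`). Helper: `torsion_three_eq_zero_of_forall_apply_eq_of_hasSurjectiveModNGaloisRep`
  (`E[3]^{Γ_ℚ} = 0` from `ρ̄_{E,3}` onto — the binder `h0` of F-B2b / F-D).

References: C.-H. Kim, AJM 148 (2026) Thm. 3.13 [Kim2022StructureSelmer]; K. Rubin, PCMI 18 (2011)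
Thm. 2.8.4, Cor. 2.8.9 [Rubin2011]; R. Sakamoto, JTNB 36 (2024) Cor. 5.5, Thm. 4.4 [Sakamoto2024].
-/

noncomputable section

open scoped Classical NumberField ContRepresentation
open Function Field NumberField IsDedekindDomain
open WeierstrassCurve Literature.NumberTheory.EllipticCurves Literature.NumberTheory.EllipticCurves.ModularForms
  Literature.NumberTheory.EllipticCurves.Rank1Residual
  Literature.NumberTheory.GaloisRepresentations
  Literature.NumberTheory.GaloisRepresentations.DiscreteGaloisModule Literature.NumberTheory.GaloisCohomology
open Literature.NumberTheory.DiophantineGeometry.Dioph (ratModP)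

namespace Summit.BirchSwinnertonDyer.Rank1Residual.GaloisImage

variable (W : WeierstrassCurve ℚ) [W.IsElliptic]

/-! ### §4 END-m2 with `hinj` discharged -/

omit [W.IsElliptic] in
/-- `E[3]^{Γ_ℚ} = 0` when `ρ̄_{E,3}` is onto: some `z` acts as `−1`, so a fixed `P` has
`2P = 0 = 3P`. (The binder `h0` of F-B2b / F-D, discharged.) [folklore] -/
theorem torsion_three_eq_zero_of_forall_apply_eq_of_hasSurjectiveModNGaloisRep
    (h3 : W.HasSurjectiveModNGaloisRep ((3 : ℕ) : ℤ)) (P : geomTorsion W ((3 : ℕ) : ℤ))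
    (hP : ∀ σ : absoluteGaloisGroup ℚ, W.torsionGaloisModule ((3 : ℕ) : ℤ) σ P = P) : P = 0 := by
  obtain ⟨z, hz⟩ := exists_smul_eq_neg_of_hasSurjectiveModNGaloisRep W ((3 : ℕ) : ℤ) h3
  have h1 : P = -P := by rw [← hz P, ← torsionGaloisModule_apply_apply, hP z]
  have h2 : P + P = 0 := by
    nth_rewrite 2 [h1]
    exact add_neg_cancel P
  have h3P : (3 : ℕ) • P = 0 := AddSubgroup.torsionBy.nsmul P
  have key : P = (3 : ℕ) • P - (P + P) := by abel
  rwa [h3P, h2, sub_zero] at key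

/-- **END-m2 "nine divides Ш" on class A2 with its injectivity input SUPPLIED by base rigidity on
the deep-class datum** (F-D's
`exists_ne_zero_mem_selmerGroup_three_of_dictionaryTwo_of_levelTwo_certificate` with `hinj` :=
`kolyvaginSystem_eq_zero_of_apply_empty_eq_zero_of_baseRigidity_deep`, F-E1; NO [S24] / S24-DEEP
binder, no tower; also SUPPLIED: `h0` from `ρ̄_{E,3}` onto, `hadm₉` = p04's
`isAdmissible_of_hasCanonicalComparison_torsion_deep`, `h𝓕₉` / `h𝓕₃` = n1011-p05 / p13, `hPS` / `hP₉`
from the pin).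
The prime class is PINNED: `D₃.primes = D₉.primes = frobeniusClassPrimes (E[3^{k′+1}]) {v | inr v ∈ S}
τ 3^{k′+1}` with `1 ≤ k′` (`k′ = 2` = the port guard's class `IsCanonicalTauDatumThreeAt W (1+1) 1`),
`τ ∈ Gal(ℚ̄/ℚ(μ_{3^{k′+1}}))`; `𝓕_can` / `𝓕̄_can` unramified outside
`S ⊇ ∞ ∪ {3} ∪ {bad}` (n1011-p05 / p13).  Remaining HYPOTHESES: the PORT `hDict` (DICT3 at depth 1),
the certificate (`hzero`, ONE level `n` with `3 · δ̃_n ≠ 0` in `ℤ/9`), `hEP`, the Poitou–Tate family,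
the parametrisation data — as in F-D.  DEBT REDUCTION on class A2, not coverage; nothing booked.
[cite: Kim2022StructureSelmer, Thm. 3.13] [cite: Rubin2011, Thm. 2.8.4 and Cor. 2.8.9 (pp. 25–26)]
[cite: Sakamoto2024, Cor. 5.5 (p. 929) and Thm. 4.4 (1) (p. 926)] -/
theorem exists_ne_zero_mem_selmerGroup_three_of_dictionaryTwo_of_levelTwo_certificate_of_baseRigidity
    [W.IsGloballyMinimal] [Finite (geomTorsion W ((3 : ℕ) : ℤ))]
    (h3 : W.HasSurjectiveModNGaloisRep ((3 : ℕ) : ℤ))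
    (inv : LocalInvariants ℚ 3) (hperf : inv.IsPerfect) (hsum : inv.SumLocalTermEqZero)
    (hcompl : inv.SelmerComplement)
    (hEP : ∀ v : HeightOneSpectrum (𝓞 ℚ), localEulerPoincareCharacteristic (v.adicCompletion ℚ))
    (S : Finset (Place ℚ)) (hS : ∀ w : InfinitePlace ℚ, (Sum.inl w : Place ℚ) ∈ S)
    (h3S : ∀ v : HeightOneSpectrum (𝓞 ℚ), ((3 : ℕ) : 𝓞 ℚ) ∈ v.asIdeal → (Sum.inr v : Place ℚ) ∈ S)
    (hbadS : ∀ v : HeightOneSpectrum (𝓞 ℚ), ¬ W.HasGoodReductionAt v → (Sum.inr v : Place ℚ) ∈ S)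
    {k' : ℕ} (hk' : 1 ≤ k') {τ : absoluteGaloisGroup ℚ}
    (hτμ : τ ∈ rootsOfUnityFixer ℚ (3 ^ (k' + 1)))
    (hτ₉ : Nonempty (cokerSubOne (W.torsionGaloisModule (((3 : ℕ) : ℤ) ^ 1 * ((3 : ℕ) : ℤ))) τ ≃+
      ZMod (3 ^ (1 + 1))))
    (hτ₃ : Nonempty (cokerSubOne (W.torsionGaloisModule ((3 : ℕ) : ℤ)) τ ≃+ ZMod 3))
    (D₉ : KolyvaginDatum (W.torsionGaloisModule (((3 : ℕ) : ℤ) ^ 1 * ((3 : ℕ) : ℤ))))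
    (D₃ : KolyvaginDatum (W.torsionGaloisModule ((3 : ℕ) : ℤ))) (hP : D₃.primes = D₉.primes)
    (hP₉ : D₉.primes = frobeniusClassPrimes
      (W.torsionGaloisModule (((3 : ℕ) : ℤ) ^ k' * ((3 : ℕ) : ℤ))) {v | (Sum.inr v : Place ℚ) ∈ S} τ
        (3 ^ (k' + 1)))
    (hT₉ : D₉.transverse = cyclotomicTransverse _) (hT₃ : D₃.transverse = cyclotomicTransverse _)
    {η : (q : HeightOneSpectrum (𝓞 ℚ)) → (ZMod (Ideal.absNorm q.asIdeal))ˣ}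
    (hD₉ : D₉.HasCanonicalComparison (3 ^ (1 + 1)) η) (hD₃ : D₃.HasCanonicalComparison 3 η)
    (v₃ : HeightOneSpectrum (𝓞 ℚ)) (hv₃ : ((3 : ℕ) : 𝓞 ℚ) ∈ v₃.asIdeal)
    (hDict : KatoKuriharaDictionaryThreeAt W 1 1 D₉ v₃)
    (hX : Addv W 3) (hc3 : ¬ 3 ∣ (W.baseChange ℚ_[3]).localTamagawaNumber ℤ_[3])
    (ht : Nat.card {Q : (W.baseChange ℚ_[3]).toAffine.Point // (3 : ℕ) • Q = 0} = 3 ^ 1)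
    {N : ℕ} [NeZero N] (P : ModularParametrizationData W N)
    (hManin : ¬ ((3 : ℕ) : ℤ) ∣ P.maninConstant)
    (hΩ : ∃ u : ℚ, ‖(u : ℚ_[3])‖ = 1 ∧ W.realPeriodRat = u * plusPeriod P.f)
    (hzero : (3 : ZMod (3 ^ (1 + 1))) * ratModP (3 ^ (1 + 1)) (ratPlusSymbol P.f 0) = 0)
    (n : Finset (HeightOneSpectrum (𝓞 ℚ))) (hn : D₉.IsLevel n)
    {ψ₀ : (ℓ : ℕ) → (ZMod ℓ)ˣ →* Multiplicative (ZMod (3 ^ (1 + 1)))}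
    (hψ₀ : ∀ q ∈ n, Function.Surjective (ψ₀ (Ideal.absNorm q.asIdeal)))
    (hcert : haveI : NeZero (∏ q ∈ n, Ideal.absNorm q.asIdeal) :=
        ⟨Finset.prod_ne_zero_iff.2 fun q _ => Assembly.absNorm_ne_zero q⟩
      (3 : ZMod (3 ^ (1 + 1))) * kuriharaNumber P.f (3 ^ (1 + 1)) (∏ q ∈ n, Ideal.absNorm q.asIdeal) ψ₀ ≠ 0) :
    ∃ x ∈ (W.kummerSelmerStructure ((3 : ℕ) : ℤ)).selmerGroup, x ≠ 0 := by
  haveI : Fact (Nat.Prime 3) := ⟨Nat.prime_three⟩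
  have h9dvd : 3 ^ (1 + 1) ∣ 3 ^ (k' + 1) := pow_dvd_pow 3 (Nat.succ_le_succ hk')
  have hτμ₉ : τ ∈ rootsOfUnityFixer ℚ (3 ^ (1 + 1)) := rootsOfUnityFixer_le_of_dvd ℚ h9dvd hτμ
  have hP₉sub : D₉.primes ⊆ frobeniusClassPrimes (W.torsionGaloisModule (((3 : ℕ) : ℤ) ^ 1 * ((3 : ℕ) : ℤ)))
      {v | (Sum.inr v : Place ℚ) ∈ S} τ (3 ^ (1 + 1)) := by
    rw [hP₉]
    exact S24Deep.frobeniusClassPrimes_torsion_pow_mul_mono W ((3 : ℕ) : ℤ) hk' _ τ h9dvd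
  have hPS : ∀ q ∈ D₉.primes, (Sum.inr q : Place ℚ) ∉ S := fun q hq => (hP₉sub hq).1
  exact exists_ne_zero_mem_selmerGroup_three_of_dictionaryTwo_of_levelTwo_certificate W h3
    (torsion_three_eq_zero_of_forall_apply_eq_of_hasSurjectiveModNGaloisRep W h3) inv hperf hsum hcompl
    hEP S h3S hbadS (propagatedSelmerStructure_isUnramifiedOutside W 3 1 S hS h3S hbadS)
    (propagatedSelmerStructureOne_three_isUnramifiedOutside W S hS h3S hbadS) hτμ₉ hτ₉ hτ₃ D₉ D₃ hP
    hP₉sub hPS hT₉ hT₃ hD₉ hD₃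
    (isAdmissible_of_hasCanonicalComparison_torsion_deep W 1 k' hk' _ hτμ hτ₉ hP₉ hD₉) v₃ hv₃ hDict hX
    hc3 ht P hManin hΩ hzero n hn hψ₀ hcert
    (kolyvaginSystem_eq_zero_of_apply_empty_eq_zero_of_baseRigidity_deep W h3 k' τ hτμ hτ₃ inv hperf
      hsum hcompl hEP S hS h3S hbadS D₃ η (hP.trans hP₉) hT₃ hD₃)

/-- **END-m2, counting form: `#Sel^{(3)}(E/ℚ) ≠ 1`** (the currency of the certificate / record
consumers), same hypotheses as
`exists_ne_zero_mem_selmerGroup_three_of_dictionaryTwo_of_levelTwo_certificate_of_baseRigidity`;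
`Sel^{(3)}` is the Selmer group of the Kummer structure
(`selmerGroup_eq_selmerGroup_kummerSelmerStructure`). DEBT REDUCTION on class A2; nothing booked.
[cite: Kim2022StructureSelmer, Thm. 3.13] [cite: Rubin2011, Thm. 2.8.4 (p. 25)] -/
theorem natCard_selmerGroup_three_ne_one_of_dictionaryTwo_of_levelTwo_certificate_of_baseRigidity
    [W.IsGloballyMinimal] [Finite (geomTorsion W ((3 : ℕ) : ℤ))]
    (h3 : W.HasSurjectiveModNGaloisRep ((3 : ℕ) : ℤ))
    (inv : LocalInvariants ℚ 3) (hperf : inv.IsPerfect) (hsum : inv.SumLocalTermEqZero)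
    (hcompl : inv.SelmerComplement)
    (hEP : ∀ v : HeightOneSpectrum (𝓞 ℚ), localEulerPoincareCharacteristic (v.adicCompletion ℚ))
    (S : Finset (Place ℚ)) (hS : ∀ w : InfinitePlace ℚ, (Sum.inl w : Place ℚ) ∈ S)
    (h3S : ∀ v : HeightOneSpectrum (𝓞 ℚ), ((3 : ℕ) : 𝓞 ℚ) ∈ v.asIdeal → (Sum.inr v : Place ℚ) ∈ S)
    (hbadS : ∀ v : HeightOneSpectrum (𝓞 ℚ), ¬ W.HasGoodReductionAt v → (Sum.inr v : Place ℚ) ∈ S)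
    {k' : ℕ} (hk' : 1 ≤ k') {τ : absoluteGaloisGroup ℚ}
    (hτμ : τ ∈ rootsOfUnityFixer ℚ (3 ^ (k' + 1)))
    (hτ₉ : Nonempty (cokerSubOne (W.torsionGaloisModule (((3 : ℕ) : ℤ) ^ 1 * ((3 : ℕ) : ℤ))) τ ≃+
      ZMod (3 ^ (1 + 1))))
    (hτ₃ : Nonempty (cokerSubOne (W.torsionGaloisModule ((3 : ℕ) : ℤ)) τ ≃+ ZMod 3))
    (D₉ : KolyvaginDatum (W.torsionGaloisModule (((3 : ℕ) : ℤ) ^ 1 * ((3 : ℕ) : ℤ))))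
    (D₃ : KolyvaginDatum (W.torsionGaloisModule ((3 : ℕ) : ℤ))) (hP : D₃.primes = D₉.primes)
    (hP₉ : D₉.primes = frobeniusClassPrimes
      (W.torsionGaloisModule (((3 : ℕ) : ℤ) ^ k' * ((3 : ℕ) : ℤ))) {v | (Sum.inr v : Place ℚ) ∈ S} τ
        (3 ^ (k' + 1)))
    (hT₉ : D₉.transverse = cyclotomicTransverse _) (hT₃ : D₃.transverse = cyclotomicTransverse _)
    {η : (q : HeightOneSpectrum (𝓞 ℚ)) → (ZMod (Ideal.absNorm q.asIdeal))ˣ}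
    (hD₉ : D₉.HasCanonicalComparison (3 ^ (1 + 1)) η) (hD₃ : D₃.HasCanonicalComparison 3 η)
    (v₃ : HeightOneSpectrum (𝓞 ℚ)) (hv₃ : ((3 : ℕ) : 𝓞 ℚ) ∈ v₃.asIdeal)
    (hDict : KatoKuriharaDictionaryThreeAt W 1 1 D₉ v₃)
    (hX : Addv W 3) (hc3 : ¬ 3 ∣ (W.baseChange ℚ_[3]).localTamagawaNumber ℤ_[3])
    (ht : Nat.card {Q : (W.baseChange ℚ_[3]).toAffine.Point // (3 : ℕ) • Q = 0} = 3 ^ 1)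
    {N : ℕ} [NeZero N] (P : ModularParametrizationData W N)
    (hManin : ¬ ((3 : ℕ) : ℤ) ∣ P.maninConstant)
    (hΩ : ∃ u : ℚ, ‖(u : ℚ_[3])‖ = 1 ∧ W.realPeriodRat = u * plusPeriod P.f)
    (hzero : (3 : ZMod (3 ^ (1 + 1))) * ratModP (3 ^ (1 + 1)) (ratPlusSymbol P.f 0) = 0)
    (n : Finset (HeightOneSpectrum (𝓞 ℚ))) (hn : D₉.IsLevel n)
    {ψ₀ : (ℓ : ℕ) → (ZMod ℓ)ˣ →* Multiplicative (ZMod (3 ^ (1 + 1)))}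
    (hψ₀ : ∀ q ∈ n, Function.Surjective (ψ₀ (Ideal.absNorm q.asIdeal)))
    (hcert : haveI : NeZero (∏ q ∈ n, Ideal.absNorm q.asIdeal) :=
        ⟨Finset.prod_ne_zero_iff.2 fun q _ => Assembly.absNorm_ne_zero q⟩
      (3 : ZMod (3 ^ (1 + 1))) * kuriharaNumber P.f (3 ^ (1 + 1)) (∏ q ∈ n, Ideal.absNorm q.asIdeal) ψ₀ ≠ 0) :
    Nat.card (W.selmerGroup (3 : ℤ)) ≠ 1 := by
  obtain ⟨x, hx, hx0⟩ :=
    exists_ne_zero_mem_selmerGroup_three_of_dictionaryTwo_of_levelTwo_certificate_of_baseRigidity W h3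
      inv hperf hsum hcompl hEP S hS h3S hbadS hk' hτμ hτ₉ hτ₃ D₉ D₃ hP hP₉ hT₉ hT₃ hD₉ hD₃ v₃ hv₃ hDict
      hX hc3 ht P hManin hΩ hzero n hn hψ₀ hcert
  intro h1
  rw [selmerGroup_eq_selmerGroup_kummerSelmerStructure] at h1
  have hbot : (W.kummerSelmerStructure ((3 : ℕ) : ℤ)).selmerGroup = ⊥ := AddSubgroup.card_eq_one.1 h1
  rw [hbot, AddSubgroup.mem_bot] at hx
  exact hx0 hx

end Summit.BirchSwinnertonDyer.Rank1Residual.GaloisImage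

end
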